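import Summits.ResolutionOfSingularities.ResolutionOfSingularities.Theorems.PurelyInseparableDim4ResConeWeightLedger
import HarnessLib
import HarnessLib.Audit.Tags

/-!
# Purely inseparable four-folds — THE WEIGHT-LEDGER CERTIFICATE SOCKET: a Boolean CHECKER for SCC certificates of the `(p, d)` ledger,
# its soundness, and ONE theorem turning `ledgerCheck p d h v = true` (a single `decide`) into «every constant-shade tail is eventually
# confined to a LIVE level of `h`», every prime `p`, every shade `d` (cell `res-dim4-pi`, K2(p) lane, rung-1 generic brick; seat res-dim4-p-8 g6)

[OURS · counted 0 · cell `res-dim4-pi` · K2(p) lane (holder res-dim4-p-12 g5, ruling g5-2 (5)) · seat res-dim4-p-8 g6.]  **HONEST LABEL.**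
BOOKKEEPING about OUR MODEL (`Step0 p` chains with cleaning on presented states of `z^p + F(x₁..x₄)`, ISOLATED regime).  Nothing here proves
any TAIL(p, d, e), K2(p), `NoIsolatedTrap p p`, CJS 6.40 or resolution of singularities in dimension ≥ 4 / characteristic `p` — NOT proved.
AI kernel work, weaker than expert review.

`…ResConeWeightLedger` (FILE 1) proves that along a constant-shade-`d` tail the boundary weights walk in the finite legal ledger, that any
ledger potential is eventually constant, and the three prunes of a level (DOCK / FT / C13).  A CERTIFICATE for `(p, d)` is a potential
`h : (Fin 4 → ℕ) → ℕ` and a VERDICT table `v : ℕ → ℕ` on its levels (`0` live · `1` no lower-band legal state · `2` no legal satellite 2-path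
inside · `3` no lossy legal edge inside).  This file is the machine that consumes it:
* §1 Boolean mirrors `legalB` / `lossyB` of `Legal` / `Lossy` (`legalB_eq_true_iff`, `lossyB_eq_true_iff`), the enumerations `vecs p` (all
  weight vectors with entries `< p − 1` — every legal state is among them, `mem_vecs_of_legal`), `flags`, `charts`, and `count a w` (the number
  of letters of weight `w`, in which S₄-invariant potentials are written);
* §2 **`ledgerCheck p d h v : Bool`** — for every legal `a ∈ vecs p`: `v (h a) ≤ 3`; verdict `1` ⇒ `a` not lower-band; for every chart / kept
  flags with legal child `b`: `h b ≤ h a`; verdict `3` and `h b = h a` ⇒ the edge is not lossy; verdict `2` and `h b = h a` ⇒ for every legal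
  grandchild `c` of the same level by a different chart, the first newborn is lost (`c j = 0`: no satellite 2-path) — and its SOUNDNESS
  **`sound_of_ledgerCheck`** (the five `∀`-hypotheses of FILE 1's prunes);
* §3 **`tail_confined_of_ledgerCheck`** (`d < p`, `e_G ≡ 2`): `ledgerCheck p d h v = true` ⇒ every witnessed isolated above-floor `Step0 p` tail
  with `x^{r₀} ∣ F₀`, constant shade `d` and `e_G ≡ 2` from `k₀` satisfies `∃ i k₁, v i = 0 ∧ k₀ ≤ k₁ ∧ ∀ k ≥ k₁, Legal p d ⇑r_k ∧ h ⇑r_k = i`;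
  **`tail_confined_of_ledgerCheck'`** — the same for ANY `e_G` (power cones) when the table uses no verdict `3`.
USE (rung 2, HOME-only until rung 0 exits — WORD #193 (δ)): `def lvl (a) := if count a 1 = … ∧ … then … else …` (reverse-topological SCC-orbit
index from the census code), `def verdict`, `theorem cert : ledgerCheck p d lvl verdict = true := by decide +kernel` (measured: all four
`d` at `p = 7` plus `(5,3)/(5,4)` in < 2 min on the farm), then `tail_confined_of_ledgerCheck … cert`.  [cite: CossartJannsenSaito2020, Thm. 3.14]
bears_on: LADDER-RESOLUTION:D157-DOOR2 (res-dim4-pi · K2(p) · weight-ledger certificate socket).  Supports stmt-ResolutionOfSingularities-16155 (helper).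
-/

set_option linter.dupNamespace false -- mandated namespace of this single-conjunct summit

noncomputable section

namespace Summit.ResolutionOfSingularities.ResolutionOfSingularities.Theorems.PIDim4

namespace ResCone

open MvPolynomial Finset Literature.AlgebraicGeometry.Resolution
open Literature.AlgebraicGeometry.Resolution.CentreBlowup Literature.AlgebraicGeometry.Resolution.Hauser2010

namespace WeightLedger

/-! ## 1. Boolean mirrors and enumerations -/

/-- Legality as a Boolean (the twelve clauses of `legal_iff_explicit`). [OURS · bookkeeping] -/
def legalB (p d : ℕ) (a : Fin 4 → ℕ) : Bool :=
  decide (p < wsum a + d) && decide (wsum a + d + 2 ≤ 2 * p) &&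
  (decide (a 0 + a 1 ≤ p - 2) && decide (a 0 + a 2 ≤ p - 2) && decide (a 0 + a 3 ≤ p - 2) && decide (a 1 + a 2 ≤ p - 2) &&
    decide (a 1 + a 3 ≤ p - 2) && decide (a 2 + a 3 ≤ p - 2)) &&
  (decide (a 0 + a 1 + a 2 ≤ p - 1) && decide (a 0 + a 1 + a 3 ≤ p - 1) && decide (a 0 + a 2 + a 3 ≤ p - 1) &&
    decide (a 1 + a 2 + a 3 ≤ p - 1))

/-- `legalB` decides `Legal`. [folklore] -/
theorem legalB_eq_true_iff {p d : ℕ} (a : Fin 4 → ℕ) : legalB p d a = true ↔ Legal p d a := by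
  rw [legal_iff_explicit]
  simp only [legalB, Bool.and_eq_true, decide_eq_true_eq]
  tauto

/-- Lossiness as a Boolean. [OURS · bookkeeping] -/
def lossyB (a b : Fin 4 → ℕ) : Bool :=
  (decide (1 ≤ a 0) && decide (b 0 = 0)) || (decide (1 ≤ a 1) && decide (b 1 = 0)) ||
  (decide (1 ≤ a 2) && decide (b 2 = 0)) || (decide (1 ≤ a 3) && decide (b 3 = 0))

/-- `lossyB` decides `Lossy`. [folklore] -/
theorem lossyB_eq_true_iff (a b : Fin 4 → ℕ) : lossyB a b = true ↔ Lossy a b := by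
  simp only [lossyB, Bool.or_eq_true, Bool.and_eq_true, decide_eq_true_eq]
  constructor
  · rintro (((h | h) | h) | h)
    exacts [⟨0, h⟩, ⟨1, h⟩, ⟨2, h⟩, ⟨3, h⟩]
  · rintro ⟨i, hi⟩
    fin_cases i <;> simp at hi <;> tauto

/-- All weight vectors with entries `< p − 1` (every legal state is one of them). [folklore] -/
def vecs (p : ℕ) : List (Fin 4 → ℕ) :=
  (List.range (p - 1)).flatMap fun a0 => (List.range (p - 1)).flatMap fun a1 =>
    (List.range (p - 1)).flatMap fun a2 => (List.range (p - 1)).map fun a3 => ![a0, a1, a2, a3]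

/-- All kept-flag vectors. [folklore] -/
def flags : List (Fin 4 → Bool) :=
  [false, true].flatMap fun s0 => [false, true].flatMap fun s1 => [false, true].flatMap fun s2 =>
    [false, true].map fun s3 => ![s0, s1, s2, s3]

/-- All charts. [folklore] -/
def charts : List (Fin 4) := [0, 1, 2, 3]

/-- **The number of letters of weight `w`** — S₄-invariant potentials are written as functions of `(count a 1, …, count a (p − 2))`.
[OURS · bookkeeping] -/
abbrev count (a : Fin 4 → ℕ) (w : ℕ) : ℕ :=
  (if a 0 = w then 1 else 0) + (if a 1 = w then 1 else 0) + (if a 2 = w then 1 else 0) + (if a 3 = w then 1 else 0)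

/-- Every legal state is enumerated by `vecs p`. [folklore] -/
theorem mem_vecs_of_legal {p d : ℕ} {a : Fin 4 → ℕ} (ha : Legal p d a) : a ∈ vecs p := by
  have h3 : 3 ≤ p := by obtain ⟨h1, h2, -, -⟩ := ha; omega
  have hlt : ∀ i, a i < p - 1 := fun i => by have := ha.apply_le i; omega
  simp only [vecs, List.mem_flatMap, List.mem_map, List.mem_range]
  refine ⟨a 0, hlt 0, a 1, hlt 1, a 2, hlt 2, a 3, hlt 3, ?_⟩
  ext i; fin_cases i <;> rfl

/-- Every flag vector is enumerated by `flags`. [folklore] -/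
theorem mem_flags (S : Fin 4 → Bool) : S ∈ flags := by
  simp only [flags, List.mem_flatMap, List.mem_map, List.mem_cons, List.not_mem_nil, or_false]
  refine ⟨S 0, by cases S 0 <;> simp, S 1, by cases S 1 <;> simp, S 2, by cases S 2 <;> simp, S 3, by cases S 3 <;> simp, ?_⟩
  ext i; fin_cases i <;> rfl

/-- Every chart is enumerated by `charts`. [folklore] -/
theorem mem_charts (j : Fin 4) : j ∈ charts := by
  fin_cases j <;> simp [charts]

/-! ## 2. The checker and its soundness -/

/-- **THE CERTIFICATE CHECKER** of the `(p, d)` weight ledger for a potential `h` and a verdict table `v` (see the module docstring).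
Kernel-reducible: `ledgerCheck p d h v = true` is ONE `decide +kernel` for concrete `p, d, h, v`. [OURS · bookkeeping] -/
def ledgerCheck (p d : ℕ) (h : (Fin 4 → ℕ) → ℕ) (v : ℕ → ℕ) : Bool :=
  (vecs p).all fun a => !legalB p d a || (
    decide (v (h a) ≤ 3) &&
    (!decide (v (h a) = 1) || !decide (LowerBand p d a)) &&
    (charts.all fun jj => flags.all fun S =>
      !legalB p d (child p d a jj S) || (
        decide (h (child p d a jj S) ≤ h a) &&
        (!decide (v (h a) = 3) || !decide (h (child p d a jj S) = h a) || !lossyB a (child p d a jj S)) &&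
        (!decide (v (h a) = 2) || !decide (h (child p d a jj S) = h a) ||
          (charts.all fun jj' => flags.all fun S' =>
            !legalB p d (child p d (child p d a jj S) jj' S') ||
            !decide (h (child p d (child p d a jj S) jj' S') = h a) || decide (jj' = jj) ||
            decide (child p d (child p d a jj S) jj' S' jj = 0))))))

/-- **SOUNDNESS OF THE CHECKER**: `ledgerCheck p d h v = true` yields the five finite hypotheses of FILE 1's potential socket — `h` is
non-increasing along legal edges; verdict-`1` levels have no lower-band legal state; verdict-`2` levels no legal satellite 2-path; verdict-`3`
levels no lossy legal edge; all verdicts on legal states are `≤ 3`. [OURS] [folklore] -/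
theorem sound_of_ledgerCheck {p d : ℕ} {h : (Fin 4 → ℕ) → ℕ} {v : ℕ → ℕ} (H : ledgerCheck p d h v = true) :
    (∀ a (jj : Fin 4) (S : Fin 4 → Bool), Legal p d a → Legal p d (child p d a jj S) → h (child p d a jj S) ≤ h a) ∧
    (∀ a, Legal p d a → v (h a) = 1 → ¬ LowerBand p d a) ∧
    (∀ a (jj : Fin 4) (S : Fin 4 → Bool) (jj' : Fin 4) (S' : Fin 4 → Bool),
      Legal p d a → Legal p d (child p d a jj S) → Legal p d (child p d (child p d a jj S) jj' S') →
      h (child p d a jj S) = h a → h (child p d (child p d a jj S) jj' S') = h a → v (h a) = 2 → jj' ≠ jj →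
      child p d (child p d a jj S) jj' S' jj = 0) ∧
    (∀ a (jj : Fin 4) (S : Fin 4 → Bool), Legal p d a → Legal p d (child p d a jj S) →
      h (child p d a jj S) = h a → v (h a) = 3 → ¬ Lossy a (child p d a jj S)) ∧
    (∀ a, Legal p d a → v (h a) ≤ 3) := by
  simp only [ledgerCheck, List.all_eq_true, Bool.or_eq_true, Bool.and_eq_true, Bool.not_eq_true',
    decide_eq_true_eq, ← Bool.not_eq_true, legalB_eq_true_iff, lossyB_eq_true_iff] at H
  refine ⟨fun a jj S ha hb => ?_, fun a ha h1 => ?_, fun a jj S jj' S' ha hb hc hhb hhc h2 hjj => ?_,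
    fun a jj S ha hb hhb h3 => ?_, fun a ha => ?_⟩
  · obtain ⟨-, hE⟩ := (H a (mem_vecs_of_legal ha)).resolve_left (not_not_intro ha)
    obtain ⟨⟨hle, -⟩, -⟩ := (hE jj (mem_charts jj) S (mem_flags S)).resolve_left (not_not_intro hb)
    exact hle
  · obtain ⟨⟨-, hLB⟩, -⟩ := (H a (mem_vecs_of_legal ha)).resolve_left (not_not_intro ha)
    exact hLB.resolve_left (not_not_intro h1)
  · obtain ⟨-, hE⟩ := (H a (mem_vecs_of_legal ha)).resolve_left (not_not_intro ha)
    obtain ⟨-, hS⟩ := (hE jj (mem_charts jj) S (mem_flags S)).resolve_left (not_not_intro hb)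
    have h4 := (hS.resolve_left fun h' => h'.elim (· h2) (· hhb)) jj' (mem_charts jj') S' (mem_flags S')
    rcases h4 with ((h4 | h4) | h4) | h4
    exacts [absurd hc h4, absurd hhc h4, absurd h4 hjj, h4]
  · obtain ⟨-, hE⟩ := (H a (mem_vecs_of_legal ha)).resolve_left (not_not_intro ha)
    obtain ⟨⟨-, hL⟩, -⟩ := (hE jj (mem_charts jj) S (mem_flags S)).resolve_left (not_not_intro hb)
    exact hL.resolve_left fun h' => h'.elim (· h3) (· hhb)
  · obtain ⟨⟨hv, -⟩, -⟩ := (H a (mem_vecs_of_legal ha)).resolve_left (not_not_intro ha)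
    exact hv

end WeightLedger

open WeightLedger

/-! ## 3. The socket: a checked certificate confines every tail to a live level -/

section Socket

variable {K : Type} [Field K] (p : ℕ) [Fact p.Prime] [CharP K p] [DecidableEq K]
  {c : ℕ → State K} {j : ℕ → Fin 4} {b : ℕ → Fin 4 → K}

/-- **THE CERTIFICATE SOCKET, binary cones** (`d < p`, `e_G ≡ 2`; every prime `p`, every shade `d`): if `ledgerCheck p d h v = true`, every
witnessed isolated above-floor `Step0 p` tail with `x^{r₀} ∣ F₀`, constant shade `d` and `e_G ≡ 2` from `k₀` is eventually confined to a level
`i` of `h` with LIVE verdict `v i = 0`, all its late boundary-weight vectors legal (`ledger_potential_eventually_constant` + the three prunes of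
FILE 1 + `sound_of_ledgerCheck`). [OURS] [cite: CossartJannsenSaito2020, Thm. 3.14] -/
theorem tail_confined_of_ledgerCheck
    (hc : ∀ k, IsIsolated p (c k).F ∧ Step0 p (c k) (c (k + 1))) (hw : FreeTail.IsWitnessedChain p c j b)
    (hr0 : ∀ e ∈ (c 0).F.support, (c 0).r ≤ e) (hfloor : ∀ k, ordZero (c k).F ≠ p) {k₀ d : ℕ} (hdp : d < p)
    (hshade : ∀ k, k₀ ≤ k → (c k).shade = (d : ℕ∞)) (he : ∀ k, k₀ ≤ k → Module.finrank K (resVertex (c k)) = 2)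
    {h : (Fin 4 → ℕ) → ℕ} {v : ℕ → ℕ} (H : ledgerCheck p d h v = true) :
    ∃ i k₁, v i = 0 ∧ k₀ ≤ k₁ ∧ ∀ k, k₁ ≤ k → Legal p d ⇑(c k).r ∧ h ⇑(c k).r = i := by
  obtain ⟨hmono, hLB, hSAT, hLOS, hv⟩ := sound_of_ledgerCheck H
  obtain ⟨i, k₁, hk₁, hlev⟩ := ledger_potential_eventually_constant p hc hw hr0 hfloor hshade h hmono
  have hleg : ∀ k, k₁ ≤ k → Legal p d ⇑(c k).r := fun k hk => tail_ledger_legal p hc hw hr0 hfloor hshade (by omega)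
  refine ⟨i, k₁, ?_, hk₁, fun k hk => ⟨hleg k hk, hlev k hk⟩⟩
  have hvi : v i ≤ 3 := by rw [← hlev k₁ le_rfl]; exact hv _ (hleg k₁ le_rfl)
  have h1 : v i ≠ 1 := fun hv1 =>
    no_tail_of_level_off_lowerBand p hc hw hr0 hfloor hshade hk₁ hlev fun a ha hai => hLB a ha (by rw [hai, hv1])
  have h2 : v i ≠ 2 := fun hv2 =>
    no_tail_of_level_satelliteFree p hc hw hr0 hfloor hshade hk₁ hlev fun a jj S jj' S' ha hb hc' hha hhb hhc hjj =>
      hSAT a jj S jj' S' ha hb hc' (by rw [hhb, hha]) (by rw [hhc, hha]) (by rw [hha, hv2]) hjj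
  have h3 : v i ≠ 3 := fun hv3 =>
    no_tail_of_level_lossfree p hc hw hr0 hfloor hdp hshade he hk₁ hlev fun a jj S ha hb hha hhb =>
      hLOS a jj S ha hb (by rw [hhb, hha]) (by rw [hha, hv3])
  omega

/-- **THE CERTIFICATE SOCKET, any polar rank** (every prime `p`, every shade `d`; serves the power cones `e_G = 3` too): the same conclusion
from a certificate using no verdict `3` (only the DOCK and FT prunes, which need no `e_G`). [OURS] [cite: CossartJannsenSaito2020, Thm. 3.14] -/
theorem tail_confined_of_ledgerCheck'
    (hc : ∀ k, IsIsolated p (c k).F ∧ Step0 p (c k) (c (k + 1))) (hw : FreeTail.IsWitnessedChain p c j b)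
    (hr0 : ∀ e ∈ (c 0).F.support, (c 0).r ≤ e) (hfloor : ∀ k, ordZero (c k).F ≠ p) {k₀ d : ℕ}
    (hshade : ∀ k, k₀ ≤ k → (c k).shade = (d : ℕ∞)) {h : (Fin 4 → ℕ) → ℕ} {v : ℕ → ℕ} (H : ledgerCheck p d h v = true)
    (hv3 : ∀ i, v i ≠ 3) : ∃ i k₁, v i = 0 ∧ k₀ ≤ k₁ ∧ ∀ k, k₁ ≤ k → Legal p d ⇑(c k).r ∧ h ⇑(c k).r = i := by
  obtain ⟨hmono, hLB, hSAT, -, hv⟩ := sound_of_ledgerCheck H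
  obtain ⟨i, k₁, hk₁, hlev⟩ := ledger_potential_eventually_constant p hc hw hr0 hfloor hshade h hmono
  have hleg : ∀ k, k₁ ≤ k → Legal p d ⇑(c k).r := fun k hk => tail_ledger_legal p hc hw hr0 hfloor hshade (by omega)
  refine ⟨i, k₁, ?_, hk₁, fun k hk => ⟨hleg k hk, hlev k hk⟩⟩
  have hvi : v i ≤ 3 := by rw [← hlev k₁ le_rfl]; exact hv _ (hleg k₁ le_rfl)
  have h1 : v i ≠ 1 := fun hv1 =>
    no_tail_of_level_off_lowerBand p hc hw hr0 hfloor hshade hk₁ hlev fun a ha hai => hLB a ha (by rw [hai, hv1])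
  have h2 : v i ≠ 2 := fun hv2 =>
    no_tail_of_level_satelliteFree p hc hw hr0 hfloor hshade hk₁ hlev fun a jj S jj' S' ha hb hc' hha hhb hhc hjj =>
      hSAT a jj S jj' S' ha hb hc' (by rw [hhb, hha]) (by rw [hhc, hha]) (by rw [hha, hv2]) hjj
  have h3 := hv3 i
  omega

end Socket

end ResCone

end Summit.ResolutionOfSingularities.ResolutionOfSingularities.Theorems.PIDim4

end
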